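import Summits.Ventures.DiscreteObjects.Hadamard.ConferenceGraph333Order5Normalizing41

/-!
# An element of order `3` normalising an element of order `37` of Aut(srg(333,166,82,83)) is a Frobenius complement with `9` fixed vertices (kernel)

Framing: lottery ticket; floor = certified bounds/negative ranges.  Cell pub-namedobj (venture DiscreteObjects),
target (H) = `H(668)`, hadamard gen 32.  Companion of `ConferenceGraph333Order5Normalizing41` at the prime `37` (`N(⟨ρ₃₇⟩)` is a `{2,3,37}`-group,
`ConferenceGraph333Normalizers41And37`): `ρ` of order `37` is fixed-point-free with `9` orbits of size `37`; if `τ` of order `3` normalises `⟨ρ⟩`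
(`τ ρ = ρ^m τ`) then `τ` does NOT commute with `ρ` (order `111` is excluded) and in the `ρ`-orbit of a `τ`-fixed vertex no other vertex is `τ`-fixed
(`37 ∤ (m−1)k`), so `#Fix τ ≤ 9`; with the window `9 ≤ #Fix τ` (gen 30):
* **`order3_normalizing_order37_structure`** — `#Fix τ = 9`, `#Fix ρ = 0`, and every `ρ`-orbit carries exactly one `τ`-fixed vertex: `⟨ρ, τ⟩ ≅ ℤ/37 ⋊ ℤ/3`
  acts as a Frobenius group on each of the nine orbits; `Fix τ` is the extremal `srg(9,4,1,2)`.  Existence of such a pair is OPEN (HANDOFF-H-g32 item 6).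
WORDS: structure of a HYPOTHETICAL object; ours (PROVISIONAL).  No `sorry`, no new definitions.
-/

namespace Summit.Ventures.DiscreteObjects.Hadamard

open Finset

section order3norm37
variable {V : Type*} [Fintype V] [DecidableEq V]

omit [Fintype V] [DecidableEq V] in
/-- coprime exponents (private copy). -/
private lemma perm_fixed_of_pow_coprime_o337 (σ : Equiv.Perm V) {a b : ℕ} (hab : Nat.Coprime a b) (hb : 1 < b)
    {x : V} (ha : (σ ^ a) x = x) (hbx : (σ ^ b) x = x) : σ x = x := by
  obtain ⟨m, -, hm⟩ := Nat.exists_mul_mod_eq_one_of_coprime hab hb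
  have h1 : (σ ^ (a * m)) x = x := by rw [pow_mul]; exact Equiv.Perm.pow_apply_eq_self_of_apply_eq_self ha m
  have h2 : (σ ^ (b * (a * m / b))) x = x := by
    rw [pow_mul]; exact Equiv.Perm.pow_apply_eq_self_of_apply_eq_self hbx _
  have e : a * m = b * (a * m / b) + 1 := by
    have := Nat.div_add_mod (a * m) b
    omega
  rw [e, pow_succ', Equiv.Perm.mul_apply, h2] at h1
  exact h1

/-- **Order `3` normalising order `37`: Frobenius structure with `9` fixed vertices.** -/
theorem order3_normalizing_order37_structure (hV : Fintype.card V = 333) (A : Matrix V V ℤ)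
    (h01 : ∀ x y, A x y = 0 ∨ A x y = 1) (hsymm : ∀ x y, A y x = A x y) (hdiag : ∀ x, A x x = 0)
    (hk : ∀ x, ∑ y, A x y = 166) (hsrg : ∀ x y, ∑ z, A x z * A z y = 83 * (1 + (if x = y then 1 else 0)) - A x y)
    (ρ τ : Equiv.Perm V) (hρ : ρ ^ 37 = 1) (hρ1 : ρ ≠ 1) (hτ : τ ^ 3 = 1) (hτ1 : τ ≠ 1) {m : ℕ} (hnorm : τ * ρ = ρ ^ m * τ)
    (hAρ : ∀ x y, A (ρ x) (ρ y) = A x y) (hAτ : ∀ x y, A (τ x) (τ y) = A x y) :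
    (univ.filter fun x => τ x = x).card = 9 ∧ (univ.filter fun x => ρ x = x).card = 0 ∧
    (∀ y, τ y = y → ρ y ≠ y → ∀ k, 0 < k → k < 37 → τ ((ρ ^ k) y) ≠ (ρ ^ k) y) := by
  classical
  haveI : Fact (Nat.Prime 37) := ⟨by norm_num⟩
  have hp37 : Nat.Prime 37 := by norm_num
  have hρo : orderOf ρ = 37 := orderOf_eq_prime hρ hρ1
  have hρx : ∀ x, (ρ ^ 37) x = x := fun x => by rw [hρ, Equiv.Perm.one_apply]
  -- the windows: #Fix ρ = 0, 9 ≤ #Fix τ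
  obtain ⟨-, -, -, -, -, -, -, w37, -, -⟩ := aut_prime_windows hV A h01 hsymm hdiag hk hsrg hp37 (by norm_num) ρ hρ hρ1 hAρ
  have hF0 : (univ.filter fun x => ρ x = x).card = 0 := w37 rfl
  have hf9 : 9 ≤ (univ.filter fun x => τ x = x).card :=
    (aut_order3_order5_fixed_lb hV A h01 hsymm hdiag hk hsrg (by norm_num : Nat.Prime 3) τ hτ hτ1 hAτ).1 rfl
  -- (1) τ does not commute with ρ
  have hnc : τ * ρ ≠ ρ * τ := by
    intro hc
    have ho3 : orderOf τ = 3 := by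
      haveI : Fact (Nat.Prime 3) := ⟨by norm_num⟩; exact orderOf_eq_prime hτ hτ1
    have hcop : Nat.Coprime (orderOf τ) (orderOf ρ) := by rw [ho3, hρo]; norm_num
    have ho : orderOf (τ * ρ) = 111 := by
      rw [(show Commute τ ρ from hc).orderOf_mul_eq_mul_orderOf_of_coprime hcop, ho3, hρo]
    have hA' : ∀ x y, A ((τ * ρ) x) ((τ * ρ) y) = A x y := fun x y => by
      rw [Equiv.Perm.mul_apply, Equiv.Perm.mul_apply, hAτ, hAρ]
    rcases aut_orderOf_of_37_dvd hV A h01 hsymm hdiag hk hsrg _ hA' (by rw [ho]; norm_num) with h | h | h <;> omega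
  -- (2) facts about m
  have hm0 : ¬ 37 ∣ m := by
    rintro ⟨c, rfl⟩
    rw [pow_mul, hρ, one_pow, one_mul] at hnorm
    exact hρ1 (mul_left_cancel (hnorm.trans (mul_one τ).symm))
  have hm1 : ¬ 37 ∣ m - 1 := by
    intro hd
    apply hnc
    have hm37 : m % 37 = 1 := by omega
    rw [hnorm, ← pow_mod_orderOf ρ m, hρo, hm37, pow_one]
  have hmpos : 1 ≤ m := by
    by_contra h
    have : m = 0 := by omega
    exact hm0 (this ▸ dvd_zero 37)
  obtain ⟨m', hm'⟩ : ∃ m', m = m' + 1 := ⟨m - 1, by omega⟩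
  have hm1' : ¬ 37 ∣ m' := by rw [hm'] at hm1; simpa using hm1
  -- (3) uniqueness of the τ-fixed vertex in a ρ-orbit
  have hτρk : ∀ k : ℕ, τ * ρ ^ k = ρ ^ (m * k) * τ := normalizing_mul_pow τ ρ hnorm
  have huniq : ∀ y, τ y = y → ρ y ≠ y → ∀ k, 0 < k → k < 37 → τ ((ρ ^ k) y) ≠ (ρ ^ k) y := by
    intro y hy hρy k hk0 hk37 hfix
    have e1 : τ ((ρ ^ k) y) = (ρ ^ (m * k)) y := by
      have := congrArg (fun g : Equiv.Perm V => g y) (hτρk k)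
      simp only [Equiv.Perm.mul_apply, hy] at this
      exact this
    rw [e1] at hfix
    have e2 : (ρ ^ (m' * k)) ((ρ ^ k) y) = (ρ ^ k) y := by
      rw [← Equiv.Perm.mul_apply, ← pow_add, show m' * k + k = m * k by rw [hm']; ring]
      exact hfix
    have hcop : Nat.Coprime (m' * k) 37 := by
      refine Nat.Coprime.mul_left ((Nat.Prime.coprime_iff_not_dvd hp37).mpr hm1').symm ?_
      exact ((Nat.Prime.coprime_iff_not_dvd hp37).mpr (fun h => by
        have := Nat.le_of_dvd hk0 h; omega)).symm
    have hz : ρ ((ρ ^ k) y) = (ρ ^ k) y := perm_fixed_of_pow_coprime_o337 ρ hcop (by norm_num) e2 (hρx _)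
    apply hρy
    rw [← perm_pow_apply_comm] at hz
    exact (ρ ^ k).injective hz
  -- (4) packing the ρ-orbits of the τ-fixed vertices into the 333 (moved) vertices
  set Y := univ.filter (fun x => τ x = x ∧ ¬ ρ x = x) with hY
  set orb : V → Finset V := fun x => (Finset.range 37).image (fun k => (ρ ^ k) x) with horb
  have horb_mem : ∀ x y, y ∈ orb x ↔ orb y = orb x := fun x y => mem_orbP_iff ρ (by norm_num) hρ x y
  have horb_card : ∀ x, ρ x ≠ x → (orb x).card = 37 := fun x hx => by
    simp only [horb]; rw [Finset.card_image_of_injOn (orbP_injOn ρ hp37 hρ x hx), Finset.card_range]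
  have hdisj : Set.PairwiseDisjoint (↑Y) orb := by
    intro y hy y' hy' hne
    rw [Finset.mem_coe, hY, Finset.mem_filter] at hy hy'
    rw [Function.onFun, Finset.disjoint_left]
    intro z hz hz'
    apply hne
    have e : orb y' = orb y := ((horb_mem y z).mp hz).symm.trans ((horb_mem y' z).mp hz') |>.symm
    have hy'mem : y' ∈ orb y := (horb_mem y y').mpr e
    obtain ⟨k, hk37, hk'⟩ := Finset.mem_image.mp hy'mem
    rw [Finset.mem_range] at hk37
    by_cases hk0 : k = 0
    · rw [hk0, pow_zero, Equiv.Perm.one_apply] at hk'; exact hk'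
    · exfalso
      have := huniq y hy.2.1 hy.2.2 k (Nat.pos_of_ne_zero hk0) hk37
      rw [hk'] at this
      exact this hy'.2.1
  have hYle : Y.card * 37 ≤ 333 := by
    have h1 : (Y.biUnion orb).card = ∑ y ∈ Y, (orb y).card := Finset.card_biUnion hdisj
    have h2 : ∑ y ∈ Y, (orb y).card = Y.card * 37 := by
      rw [Finset.sum_congr rfl fun y hy => horb_card y (by rw [hY, Finset.mem_filter] at hy; exact hy.2.2),
        Finset.sum_const, smul_eq_mul]
    have h3 : (Y.biUnion orb).card ≤ (univ : Finset V).card := Finset.card_le_card (Finset.subset_univ _)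
    rw [h1, h2, Finset.card_univ, hV] at h3
    exact h3
  -- (5) assemble
  have hsplit := Finset.card_filter_add_card_filter_not (s := univ.filter fun x => τ x = x) (fun x => ρ x = x)
  rw [Finset.filter_filter, Finset.filter_filter] at hsplit
  have hle0 : (univ.filter fun x => τ x = x ∧ ρ x = x).card ≤ 0 := by
    rw [← hF0]; exact Finset.card_le_card (fun x hx => by
      rw [Finset.mem_filter] at hx ⊢; exact ⟨hx.1, hx.2.2⟩)
  have hYeq : (univ.filter fun x => τ x = x ∧ ¬ ρ x = x) = Y := rfl
  rw [hYeq] at hsplit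
  exact ⟨by omega, hF0, huniq⟩

end order3norm37

end Summit.Ventures.DiscreteObjects.Hadamard
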